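import Literature.MathematicalPhysics.QuantumFieldTheory.Balaban1983to89.T3MinimiserStabilityReduction
import Literature.MathematicalPhysics.QuantumFieldTheory.Balaban1983to89.T3PrintedRegularMinimiser
import Literature.MathematicalPhysics.QuantumFieldTheory.Balaban1983to89.T3OrbitAverage
import Literature.MathematicalPhysics.QuantumFieldTheory.Balaban1983to89.B12ContinuousTransportInvariance
import Literature.MathematicalPhysics.QuantumFieldTheory.Balaban1983to89.Node00.CanonicalTransportOfRecord
import Summits.QuantumFields.YangMills.Theorems.FluctuationComparisonRegPrIntLWreg
import Summits.QuantumFields.YangMills.Theorems.FluctuationComparisonRegPrIntLS2BetaKPLogRep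
import Literature.Probability.LatticeModels.AnchoredClusterExpansion
import HarnessLib

/-!
# LINE g19-1 · «LARGE-FIELD GAS TABLE FOR LFRᶜ» — v3 (ideator seat ym-r3-idea-1, generation g19; lens «control»)

**v3: KPL CLOSED BY NAME** — `theorem stub_kpLogRep : KPLogRep := Summit.QuantumFields.YangMills.Theorems.FluctuationComparisonRegPrIntLS2BetaKPLogRep.kpLogRep`
(δ-unfolding only) on pen ym-ust-20520-w3 g15's LANDED Theorems files KPL-A `…S2BetaKPLIncrement` (✓p744391: `log Z(B ∪ x) = log Z(B) + Log(1 + v_x Z(Bˣ)/Z(B))`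
on the real KP segment), KPL-B `…S2BetaKPLExpansion` (the Taylor/Möbius `HasSum` for `Φ^T(v; C ∪ x)`), KPL-C `…S2BetaKPLSignMajorant` (THE ALTERNATING-SIGN
MAJORANT `sign_majorant` / `norm_truncatedWeight_le_norm_neg`: `‖Φ^T(v;C)‖ ≤ −Re Φ^T(−r;C)` on the polydisc `‖v‖ ≤ r` — [ScottSokal2005] Prop. 2.8 in set-resummed
form, the ingredient v1/v2 named as missing from the tree) and KPL-D `…S2BetaKPLogRep` (`polymerRep_of_kpGas`, generic and gauge-free; `kpLogRep` = `KPLogRep`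
unfolded token for token; ✓p744986, commit d28cc4cdd91d; KPL-B ✓p744575, KPL-C ✓p744796).  No def text changed (v2/v2.1 texts byte-identical); live sorries 1 = {LFG `stub_largeFieldGasRepCan`}.

v2 = v1 @6072c41ed23d with critic idea-crit-5 g9 #365 (PASS-WITH-PRICE, light) prices paid: **P2** LFG WEAKENED by a field-INDEPENDENT normalisation —
its identity now reads `ρ = e^{c}·heightDensityCan^{histGood}·Ξ(w)` with `∃ c : ℝ` (print's (1.72)/(1.90) carry partition-function normalisation factors between
the densities; LFRᶜ's `PolymerRepOn` has a free constant, which absorbs `c`: `polymerRepOn_const_add`, PROVED), the composition re-proved; **P3** KPL's docstring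
states the cluster-GROUPING by support that its proof must perform (finitely many supports ↔ `Fin n` polymers) and the termwise alternative to the sign
majorant; **P1** (wall conserved — said on the card): LFG is exactly where the organ's XL hand goes; the line relocates LFRᶜ's difficulty into print's gas
format 1-for-1 minus the KP bookkeeping — no hand is retired by it; **P4** the prefix `pS ≤ p₀` is KEPT (load-bearing, falsifier).

Crux of record: `stmt-QuantumFields-20520` (`UnitScaleTilt.FluctuationComparisonRegPrIntL`); package of record
`Cruxes/FluctuationComparisonRegPrIntL/Lines/runpair_organ.lean` (v15), registered input **S2β `FluctuationPartSmall`** via LINE g18-1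
`Lines/semiclassical_s2beta.lean` v7 (composition 1L4ᶜ → H4ᶜ → LFR♯ᶜ → S2β PROVED there, and LFRᶜ ⇒ LFR♯ᶜ PROVED there,
`largeFieldFourPtCan_of_polymerRep`).  TARGET OF THIS LINE = the organ **LFRᶜ `LargeFieldPolymerRepCan`** (LINE g17-1 row LFR over the
canonical version; XL; NO HAND and NO LINE before this one — g18 FINAL «OPEN after this seat»), restated VERBATIM in §0 (the farm cannot import
`Cruxes/…/Lines/*.lean`; closure is BY TEXT: `LargeFieldPolymerRepCan` below is `Iff.rfl`-identical to LINE g18-1 v7's / LINE g17-1 v5's).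

THE CONTROL TABLE (lens «control»: the controlling quantity is the **Kotecký–Preiss activity norm of the LARGE-FIELD POLYMER GAS**, i.e. Bałaban's
𝐑-operation output read at ACTIVITY level (1.90)/(1.97) — one level BELOW the cluster-level polymer norm `‖·‖_κ` of the LOGARITHM that LINE g17-1's
LFR row and §0's `PolymerRepOn` measure):

* **LFG `LargeFieldGasRepCan`** (organ stub, XL, the 𝐑-operation for the T³ tower): on the `θ_J`-window, for every continuous positive window
  version `ρ` of the nested unit law at height `J ≤ K`, the RATIO `ρ / heightDensityCan^{histGood}` IS the partition function of a HARD-CORE GAS of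
  bond polymers of the height-`J` lattice (`polyInc`: equal or overlapping supports), whose activities are REAL, V-LOCAL (depend on the window field
  only through the bonds of the polymer) and dominated ON THE WINDOW by a field-INDEPENDENT majorant `w̄` obeying the Kotecký–Preiss inequality
  with decay weight `κ·ℓ(X)` (`ℓ(X) ≥` the source-distance diameter of `X`) and size function `a`, the size of a ONE-BOND polymer being `≤ Ψ J`,
  `J·Ψ J → 0`, uniformly in the depth `K − J` — print: [Balaban1989LargeFieldII] (1.72) p.379, (1.90)–(1.92) p.388, (1.97) p.389, (1.100)–(1.101)
  p.390 («|𝐑′^{(k)}(X)| ≤ exp(−p₀(g_k)) exp(−κ d_k(X))», «depends on U_k restricted to X»); d = 3: [Balaban1985UV3] (38)–(46) pp.265–267 (the nested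
  large-field regions `Ω_j ⊃ Ω_{j+1}`, the boundary terms, and «the condition n ≥ 2 plays a crucial role»).  The height-`J` footprint of a multi-scale
  large-field domain is what `polyInc` sees; activities of domains with equal footprint are summed (a compatible family never contains two of them).
* **KPL `KPLogRep`** (abstract stub, M, cluster expansion — NO gauge theory, NO densities): a KP-small hard-core gas of bond polymers with V-local real
  activities dominated on a window `W` by a KP majorant represents `U ↦ log Ξ(w_U)` as a `PolymerRepOn W κ N` (field-UNIFORM weight table).  Proof plan
  (named, all but one step in the tree): [KP86] (2) `polymerLogZ_eq_sum_truncatedWeight` (act_C := Re Φ^T_{w_U}(C), V-local by `truncatedWeight_congr`,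
  supported on `⋃ C`, `len C := Σ_{X∈C} ℓ X` by the cluster-chain triangle inequality `reflTransGen_clusterSupp_of_isPolymerCluster'`), non-clusters
  vanish `truncatedWeight_eq_zero_of_kp`, the pinned bound = estimate (4) at the one-bond polymer `{e}` (`sum_norm_truncatedWeight_mul_exp_le_of_touches`
  with the DISCHARGED `koteckyPreiss_truncatedWeight_bound_holds`) for the MAJORANT gas `−w̄`, `Real.log Ξ = Re log Ξ` for real activities
  (`polymerLogZ_eq_log_of_real`), and the ONE step not in the tree: the **alternating-sign majorant** `‖Φ^T_{w}(C)‖ ≤ ‖Φ^T_{−w̄}(C)‖` for `‖w‖ ≤ w̄`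
  KP-small ([ScottSokal2005] Prop. 2.8 «signs of Mayer coefficients»: «(−1)^{|n|−1} c_n(W) ≥ 0 for 0 ≤ W ≤ 1», crediting [Groeneveld1962]) — which is what makes the
  weight table FIELD-UNIFORM, as `PolymerRepOn` demands.
* **PROVED**: `largeFieldPolymerRepCan_of : KPLogRep → LargeFieldGasRepCan → LargeFieldPolymerRepCan` (`log ρ − log g = log Ξ` on the window from
  `ρ = g·Ξ`, `ρ, g > 0`; a polymer representation only reads its function on the window, `polymerRepOn_congr`).

WHY THIS CUT (and not LINE g17's rejected «tail + ratio factorisation + KP»): there the RATIO FACTORISATION stub carried the whole content and KP was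
decoration.  Here the XL stub IS print's object — the exponentiated-cluster-expansion INPUT (1.90)/(1.97): a gas identity with activity-level bounds —
typed over the trunk in the window currency (`θBal`, `histGood`, `heightDensityCan`), and EVERYTHING AFTER THE GAS (exponentiation (1.98), localisation
(1.99), field-uniform weights, pinned smallness, the log identity) is discharged or isolated in the gauge-free lemma KPL whose one new ingredient is
named.  A large-field HAND now has a typed target in Bałaban's own format instead of the cluster-level `PolymerRepOn`.

Sorries (v3) = {LFG `stub_largeFieldGasRepCan` (XL, organ)}; KPL `stub_kpLogRep` is CLOSED BY NAME (w3-20520 g15); 0 elsewhere.  No summit is proved by a line; `YM3TorusSU2`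
is NOT proved (the package's other inputs S1a, 26243, S2α′, O1 and S2β's other organs EXW, GAP♯, LAPLACE, H4ᶜ stay open); nothing of Bałaban's asserted.
-/

noncomputable section

open MeasureTheory Filter Topology Set
open Literature.MathematicalPhysics.QuantumFieldTheory.Balaban1983to89
open Literature.MathematicalPhysics.QuantumFieldTheory.Balaban1983to89.T3ContinuumYM3Torus
open Literature.MathematicalPhysics.QuantumFieldTheory.Balaban1983to89.T3NestedUnitLaws
open Literature.MathematicalPhysics.QuantumFieldTheory.Balaban1983to89.T3UnitLawDensityEML
open Literature.MathematicalPhysics.QuantumFieldTheory.Balaban1983to89.T3UnitScaleTilt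
open Literature.MathematicalPhysics.QuantumFieldTheory.Balaban1983to89.T3TiltDescent
open Literature.MathematicalPhysics.QuantumFieldTheory.Balaban1983to89.T3PrintedRegularMinimiser
open Literature.MathematicalPhysics.QuantumFieldTheory.Balaban1983to89.T3ConstrainedMinimiser (fibre)
open Literature.MathematicalPhysics.QuantumFieldTheory.Balaban1983to89.T3LevelShift
open Literature.MathematicalPhysics.QuantumFieldTheory.Balaban1983to89.Missing
open Literature.MathematicalPhysics.QuantumFieldTheory.Balaban1983to89.T4Continuum
open scoped Literature.MathematicalPhysics.QuantumFieldTheory.Balaban1983to89.T3OrbitAverage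

namespace Summit.QuantumFields.YangMills.Cruxes.FluctuationComparisonRegPrIntL.RunPairOrgan.LargeFieldGas

/-! ## §0 Verbatim restatements from LINE g18-1 `Lines/semiclassical_s2beta.lean` v7 (by-text closure): the canonical version, the polymer
calculus, and the TARGET organ LFRᶜ -/

section Canonical

variable (F : T3Family) (γ : ℝ) {J K : ℕ} (hJK : J ≤ K) (S : Set (GaugeField (F.P K) 0 (Matrix.specialUnitaryGroup (Fin 2) ℂ)))

/-- **THE CANONICAL VERSION OF BAŁABAN'S RESTRICTED DENSITY AT HEIGHT `K − J`** (verbatim from LINE g18-1 v7 §1). [cite: Balaban1985UV3, (2) p.256 and (41) p.266] -/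
def heightDensityCan (V : GaugeField (F.P J) 0 (Matrix.specialUnitaryGroup (Fin 2) ℂ)) : ℝ :=
  Node00.canonVersion (fieldMeasure (F.P J) 0 (Matrix.specialUnitaryGroup (Fin 2) ℂ)) (heightDensity F γ hJK S) V

end Canonical

section PolymerCalculus

variable {P : Params} {G : Type*} {n : ℕ}

/-- **V-LOCALITY** (verbatim from LINE g18-1 v7 §1b / LINE g17-1). [cite: Balaban1987RG1, (0.22)] -/
def IsLocal (supp : Fin n → Finset (PBond P 0)) (act : Fin n → GaugeField P 0 G → ℝ) : Prop :=
  ∀ X (U U' : GaugeField P 0 G), (∀ e ∈ supp X, U e = U' e) → act X U = act X U'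

open Classical in
/-- **A V-LOCAL POLYMER REPRESENTATION OF `f` ON THE WINDOW `W` WITH WEIGHTED NORM `≤ N` AT RATE `κ`** (verbatim from LINE g18-1 v7 §1b / LINE g17-1).
[cite: Balaban1987RG1, (0.23)-(0.26)] -/
def PolymerRepOn (W : Set (GaugeField P 0 G)) (κ N : ℝ) (f : GaugeField P 0 G → ℝ) : Prop :=
  ∃ (n : ℕ) (supp : Fin n → Finset (PBond P 0)) (len wt : Fin n → ℝ) (act : Fin n → GaugeField P 0 G → ℝ) (c : ℝ),
    IsLocal supp act ∧ (∀ X, 0 ≤ wt X) ∧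
    (∀ X, ∀ e ∈ supp X, ∀ e' ∈ supp X, (e.src.tdist e'.src : ℝ) ≤ len X) ∧
    (∀ X U, U ∈ W → |act X U| ≤ wt X) ∧
    (∀ e : PBond P 0, ∑ X ∈ Finset.univ.filter (fun X => e ∈ supp X), wt X * Real.exp (κ * len X) ≤ N) ∧
    ∀ U, U ∈ W → f U = c + ∑ X, act X U

/-- A polymer representation only reads its function ON the window (PROVED; the transfer used by the composition). [cite: Balaban1987RG1, (0.23)-(0.26)] -/
theorem polymerRepOn_congr {W : Set (GaugeField P 0 G)} {κ N : ℝ} {f g : GaugeField P 0 G → ℝ} (h : PolymerRepOn W κ N g)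
    (hfg : ∀ U, U ∈ W → f U = g U) : PolymerRepOn W κ N f := by
  obtain ⟨n, supp, len, wt, act, c, hloc, hwt, hdiam, hbd, hcov, hrep⟩ := h
  exact ⟨n, supp, len, wt, act, c, hloc, hwt, hdiam, hbd, hcov, fun U hU => by rw [hfg U hU]; exact hrep U hU⟩

/-- A polymer representation absorbs a field-INDEPENDENT additive constant (PROVED; v2: the normalisation `e^{c}` of LFG lands in LFRᶜ's free constant).
[cite: Balaban1987RG1, (0.23)-(0.26)] -/
theorem polymerRepOn_const_add {W : Set (GaugeField P 0 G)} {κ N : ℝ} {f : GaugeField P 0 G → ℝ} (h : PolymerRepOn W κ N f) (a : ℝ) :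
    PolymerRepOn W κ N (fun U => a + f U) := by
  obtain ⟨n, supp, len, wt, act, c, hloc, hwt, hdiam, hbd, hcov, hrep⟩ := h
  exact ⟨n, supp, len, wt, act, a + c, hloc, hwt, hdiam, hbd, hcov, fun U hU => by show a + f U = _; rw [hrep U hU]; ring⟩

end PolymerCalculus

section Target

/-- **LFRᶜ · LARGE-FIELD POLYMER REMAINDER OVER THE CANONICAL VERSION — THE TARGET ORGAN OF THIS LINE**, verbatim from LINE g18-1 v7 §2 (= LINE g17-1 v5 row
LFR over the canonical version). [cite: Balaban1988Convergent, §2 (2.18)-(2.27); Balaban1989LargeFieldI, §1] -/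
def LargeFieldPolymerRepCan : Prop :=
  ∀ (L : ℕ), ∃ pS : ℝ, ∀ (b₀ p₀ : ℝ), 0 < b₀ → pS ≤ p₀ → 0 < p₀ →
    ∃ γ₁ : ℝ, 0 < γ₁ ∧ ∃ κ : ℝ, 0 < κ ∧ ∀ (F : T3Family) (γ : ℝ), F.L = L → 0 < γ → γ ≤ γ₁ →
      ∃ Ψ : ℕ → ℝ, (∀ J, 0 ≤ Ψ J) ∧ Tendsto (fun J : ℕ => (J : ℝ) * Ψ J) atTop (𝓝 0) ∧
        ∀ (ν : ℕ → (j : ℕ) → Measure (GaugeField (F.P j) 0 (Matrix.specialUnitaryGroup (Fin 2) ℂ))),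
          (∀ K, ν K K = T4GenFunBounds.gibbsMeasure (F.P K) ((F.scheme ℰp γ).β K)) →
          (∀ K j, j < K → ν K j = Measure.map (descend F ℰp j) (ν K (j + 1))) →
          ∀ (J K : ℕ) (hJK : J ≤ K) (ρ : GaugeField (F.P J) 0 (Matrix.specialUnitaryGroup (Fin 2) ℂ) → ℝ),
            (∀ U, PlaqSmall (θBal F.L γ b₀ p₀ J) U → 0 < ρ U) →
            ν K J = (fieldMeasure _ _ _).withDensity (fun U => ENNReal.ofReal (ρ U)) →
            ContinuousOn ρ {U | PlaqSmall (θBal F.L γ b₀ p₀ J) U} →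
            (∀ U : GaugeField (F.P J) 0 (Matrix.specialUnitaryGroup (Fin 2) ℂ), PlaqSmall (θBal F.L γ b₀ p₀ J) U →
                0 < heightDensityCan F γ hJK (histGood F ℰp (θBal F.L γ b₀ p₀) K J) U) →
            PolymerRepOn {U | PlaqSmall (θBal F.L γ b₀ p₀ J) U} κ (Ψ J)
              (fun U => Real.log (ρ U) - Real.log (heightDensityCan F γ hJK (histGood F ℰp (θBal F.L γ b₀ p₀) K J) U))

end Target

/-! ## §1 The activity-level format: V-local hard-core gases of bond polymers with a field-uniform Kotecký–Preiss majorant -/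

section Gas

variable {P : Params} {G : Type*}

/-- **V-LOCAL ACTIVITIES**: the activity of the bond polymer `X` depends on the field only through the bonds of `X` ([Balaban1989LargeFieldII] p.390
«𝐑′^{(k)}(X) depends on the background field U_k restricted to X»). [cite: Balaban1989LargeFieldII, (1.99) p.390] -/
def IsLocalActivity (w : GaugeField P 0 G → Finset (PBond P 0) → ℝ) : Prop :=
  ∀ (X : Finset (PBond P 0)) (U U' : GaugeField P 0 G), (∀ e ∈ X, U e = U' e) → w U X = w U' X

open Classical in
/-- **THE HARD-CORE GAS PARTITION FUNCTION OF THE FIELD-DEPENDENT ACTIVITIES** `Ξ(w_U) = Σ_{compatible families} Π w_U(X)` over ALL bond polymers of the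
lattice, incompatible iff equal or overlapping (`polyInc`) — the curly bracket `{⋯} = 1 + Σ_r Σ_{{X′₁,…,X′_r}} Π_p F(X′_p)` of (1.90) (real part: the
activities are real). [cite: Balaban1989LargeFieldII, (1.90) p.388] -/
def gasZ (w : GaugeField P 0 G → Finset (PBond P 0) → ℝ) (U : GaugeField P 0 G) : ℝ :=
  (Literature.Probability.LatticeModels.polymerPartitionFunction Literature.Probability.LatticeModels.polyInc
    (fun X : Finset (PBond P 0) => ((w U X : ℝ) : ℂ)) Finset.univ).re

open Classical in
/-- **A KOTECKÝ–PREISS GAS ON THE WINDOW `W` AT RATE `κ` WITH ONE-BOND SIZE `≤ N`**: real V-local activities vanishing on the empty polymer, a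
field-INDEPENDENT majorant `w̄ ≥ |w_U|` on `W`, lengths `ℓ X ≥` the source-distance diameter of `X`, a size function `a ≥ 0` with the Kotecký–Preiss
inequality `Σ_{X′ ι X} w̄ X′ · e^{a X′ + κ ℓ X′} ≤ a X` ([KP86] (1) with `d = κℓ`) and `a {e} ≤ N` for every bond `e` (the pinned size; print's
`exp(−p₀(g_k))` of (1.100)). [cite: Balaban1989LargeFieldII, (1.97) p.389 and (1.100) p.390; KoteckyPreiss1986, Theorem p.492 (1)] -/
def KPGasOn (W : Set (GaugeField P 0 G)) (κ N : ℝ) (w : GaugeField P 0 G → Finset (PBond P 0) → ℝ) : Prop :=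
  ∃ (wbar a ℓ : Finset (PBond P 0) → ℝ),
    (∀ U, w U ∅ = 0) ∧ IsLocalActivity w ∧ (∀ X, 0 ≤ a X) ∧ (∀ X, 0 ≤ ℓ X) ∧
    (∀ U, U ∈ W → ∀ X, |w U X| ≤ wbar X) ∧
    (∀ X : Finset (PBond P 0), ∀ e ∈ X, ∀ e' ∈ X, (e.src.tdist e'.src : ℝ) ≤ ℓ X) ∧
    (∀ X : Finset (PBond P 0), ∑ X' ∈ Finset.univ.filter (fun X' => Literature.Probability.LatticeModels.polyInc X' X),
        wbar X' * Real.exp (a X' + κ * ℓ X') ≤ a X) ∧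
    (∀ e : PBond P 0, a {e} ≤ N)

/-- **SIZE ZERO ⇒ the empty gas** (PROVED sanity instance: the predicate is inhabited exactly by what it should be at size zero — zero activities, majorant
`0`, size function `0`, lengths the double sum of source distances). [cite: KoteckyPreiss1986, Theorem p.492 (1)] -/
theorem kpGasOn_zero (W : Set (GaugeField P 0 G)) (κ N : ℝ) (hN : 0 ≤ N) : KPGasOn W κ N (fun _ _ => 0) := by
  refine ⟨fun _ => 0, fun _ => 0, fun X => ∑ e ∈ X, ∑ e' ∈ X, ((e.src.tdist e'.src : ℕ) : ℝ), fun _ => rfl, fun _ _ _ _ => rfl,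
    fun _ => le_rfl, ?_, ?_, ?_, ?_, fun _ => hN⟩
  · intro X; exact Finset.sum_nonneg fun e _ => Finset.sum_nonneg fun e' _ => Nat.cast_nonneg _
  · intro U _ X; simp
  · intro X e he e' he'
    have h1 : ((e.src.tdist e'.src : ℕ) : ℝ) ≤ ∑ e'' ∈ X, ((e.src.tdist e''.src : ℕ) : ℝ) :=
      Finset.single_le_sum (f := fun e'' : PBond P 0 => ((e.src.tdist e''.src : ℕ) : ℝ)) (fun i _ => Nat.cast_nonneg _) he'
    have h2 : ∑ e'' ∈ X, ((e.src.tdist e''.src : ℕ) : ℝ) ≤ ∑ e₁ ∈ X, ∑ e'' ∈ X, ((e₁.src.tdist e''.src : ℕ) : ℝ) :=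
      Finset.single_le_sum (f := fun e₁ : PBond P 0 => ∑ e'' ∈ X, ((e₁.src.tdist e''.src : ℕ) : ℝ))
        (fun i _ => Finset.sum_nonneg fun _ _ => Nat.cast_nonneg _) he
    exact h1.trans h2
  · intro X
    refine (Finset.sum_eq_zero fun X' _ => ?_).le
    exact zero_mul _

end Gas

/-- **KPL · THE CLUSTER-EXPANSION LEMMA (abstract, gauge-free; stub M)**: for every lattice and every window `W`, a Kotecký–Preiss gas on `W` at rate
`κ ≥ 0` with one-bond size `≤ N` represents `U ↦ log Ξ(w_U)` as a V-local polymer representation on `W` of weighted norm `≤ N` at rate `κ` — (1.98)/(1.99):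
`{⋯} = exp Σ_X 𝐑′(X)` with `𝐑′(X)` local and exponentially small in `d(X)`; field-UNIFORM weights by the alternating-sign majorant `‖Φ^T_w(C)‖ ≤ ‖Φ^T_{−w̄}(C)‖`.
PROVER NOTES (v2.1, critic #365 P3 — typing of the `Fin n` index): in the tree's formalisation the truncated functional
`Literature.Probability.LatticeModels.truncatedWeight inc w C` is indexed by finite SETS `C : Finset (Finset (PBond P 0))` of polymers (multiplicities are
resummed inside its Möbius definition), so [KP86] (2) `polymerLogZ_eq_sum_truncatedWeight : log Ξ = Σ_{C ⊆ univ} Φ^T(C)` is a FINITE sum and `PolymerRepOn`'s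
`Fin n` indexes the `C`'s directly (`Fintype.equivFin`); `supp C := ⋃ C`, locality from `truncatedWeight_congr` + `IsLocalActivity`, `len C := Σ_{X ∈ C} ℓ X`
(≥ the source-diameter of `⋃ C` on clusters, chain argument `reflTransGen_clusterSupp_of_isPolymerCluster'`; non-clusters have `Φ^T = 0`,
`truncatedWeight_eq_zero_of_kp`), `Real.log (gasZ w U) = Re (polymerLogZ …)` from `exp_polymerLogZ_of_kp` (real activities, `Ξ > 0` along the KP ray).  The ONE
ingredient not in the tree is the field-UNIFORM majorant `|Re Φ^T_{w_U}(C)| ≤ −Re Φ^T_{−w̄}(C)` for `|w_U| ≤ w̄` (alternating-sign property of the set-resummed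
truncated functional for the repulsive relation `polyInc`, [ScottSokal2005] Prop. 2.8 / [KoteckyPreiss1986] proof of (4)); with it, KP (4) for the majorant gas
(`sum_norm_truncatedWeight_mul_exp_le_of_touches` with `d := κ ℓ`, size `a`) gives the pinned bound `≤ a {e} ≤ N`.
[cite: Balaban1989LargeFieldII, (1.98)-(1.99) p.390; KoteckyPreiss1986, Theorem p.492 (2),(4); ScottSokal2005, Prop. 2.8] -/
def KPLogRep : Prop :=
  ∀ (P : Params) (W : Set (GaugeField P 0 (Matrix.specialUnitaryGroup (Fin 2) ℂ))) (κ N : ℝ), 0 ≤ κ →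
    ∀ w : GaugeField P 0 (Matrix.specialUnitaryGroup (Fin 2) ℂ) → Finset (PBond P 0) → ℝ,
      KPGasOn W κ N w → PolymerRepOn W κ N (fun U => Real.log (gasZ w U))

/-! ## §2 The organ LFG: the large-field remainder IS a Kotecký–Preiss gas on the window (Bałaban's 𝐑-operation output, one run, all depths) -/

section Organ

/-- **LFG · LARGE-FIELD GAS REPRESENTATION OVER THE CANONICAL VERSION (organ stub, XL)**: with LFRᶜ's quantifier prefix VERBATIM — for every block size `L` a
threshold exponent `pS`, for `b₀ > 0`, `p₀ ≥ pS`, a coupling ceiling `γ₁` and a rate `κ > 0`, for every family with `F.L = L` and `0 < γ ≤ γ₁` a budget `Ψ ≥ 0`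
with `J·Ψ J → 0`, such that for every consistent tower `ν K ·` of push-forwards of run `K`'s Gibbs law, all heights `J ≤ K`, and every continuous positive
window version `ρ` of `ν K J` (given positivity of the canonical small-history density on the window) — there is a V-local real activity `w` on the bond
polymers of `(F.P J)₀` forming a Kotecký–Preiss gas on the `θ_J`-window at rate `κ` with one-bond size `≤ Ψ J`, and ON THE WINDOW
`ρ = heightDensityCan^{histGood} · Ξ(w_·)`: the 𝐑-operation's (1.72)/(1.90) with the bounds (1.97)/(1.100), composed over the scales `J+1, …, K` and read
on the height-`J` footprints.  NOT PRINTED for d = 3 beyond the inequality form [Balaban1985UV3] (41)/(47); the identity form is [Balaban1989LargeFieldII]'s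
(d = 4). Why it might fail: the T³ tower's small-field split is `histGood` (sharp characteristic functions at EVERY intermediate level), so the window
version `ρ/g` carries boundary polymers pinned at depth-`j` constraint surfaces whose activities are small only by `exp(−¼p(g_j)²)` against `L^{3(j−J)}`
positions — the pinned size `a {e} ≤ Ψ J` needs `p₀` above a threshold (`pS`), which the prefix grants. [cite: Balaban1989LargeFieldII, (1.90) p.388, (1.97) p.389, (1.100)-(1.101) p.390; Balaban1985UV3, (38)-(46) pp.265-267] -/
def LargeFieldGasRepCan : Prop :=
  ∀ (L : ℕ), ∃ pS : ℝ, ∀ (b₀ p₀ : ℝ), 0 < b₀ → pS ≤ p₀ → 0 < p₀ →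
    ∃ γ₁ : ℝ, 0 < γ₁ ∧ ∃ κ : ℝ, 0 < κ ∧ ∀ (F : T3Family) (γ : ℝ), F.L = L → 0 < γ → γ ≤ γ₁ →
      ∃ Ψ : ℕ → ℝ, (∀ J, 0 ≤ Ψ J) ∧ Tendsto (fun J : ℕ => (J : ℝ) * Ψ J) atTop (𝓝 0) ∧
        ∀ (ν : ℕ → (j : ℕ) → Measure (GaugeField (F.P j) 0 (Matrix.specialUnitaryGroup (Fin 2) ℂ))),
          (∀ K, ν K K = T4GenFunBounds.gibbsMeasure (F.P K) ((F.scheme ℰp γ).β K)) →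
          (∀ K j, j < K → ν K j = Measure.map (descend F ℰp j) (ν K (j + 1))) →
          ∀ (J K : ℕ) (hJK : J ≤ K) (ρ : GaugeField (F.P J) 0 (Matrix.specialUnitaryGroup (Fin 2) ℂ) → ℝ),
            (∀ U, PlaqSmall (θBal F.L γ b₀ p₀ J) U → 0 < ρ U) →
            ν K J = (fieldMeasure _ _ _).withDensity (fun U => ENNReal.ofReal (ρ U)) →
            ContinuousOn ρ {U | PlaqSmall (θBal F.L γ b₀ p₀ J) U} →
            (∀ U : GaugeField (F.P J) 0 (Matrix.specialUnitaryGroup (Fin 2) ℂ), PlaqSmall (θBal F.L γ b₀ p₀ J) U →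
                0 < heightDensityCan F γ hJK (histGood F ℰp (θBal F.L γ b₀ p₀) K J) U) →
            ∃ (c : ℝ) (w : GaugeField (F.P J) 0 (Matrix.specialUnitaryGroup (Fin 2) ℂ) → Finset (PBond (F.P J) 0) → ℝ),
              KPGasOn {U | PlaqSmall (θBal F.L γ b₀ p₀ J) U} κ (Ψ J) w ∧
              ∀ U : GaugeField (F.P J) 0 (Matrix.specialUnitaryGroup (Fin 2) ℂ), PlaqSmall (θBal F.L γ b₀ p₀ J) U →
                ρ U = Real.exp c * heightDensityCan F γ hJK (histGood F ℰp (θBal F.L γ b₀ p₀) K J) U * gasZ w U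

end Organ

/-! ## §3 PROVED: KPL → LFG → LFRᶜ -/

/-- **THE COMPOSITION (PROVED)**: on the window `ρ = g·Ξ` with `ρ, g > 0` forces `Ξ = ρ/g > 0` and `log ρ − log g = log Ξ`; KPL represents `log Ξ`; a polymer
representation only reads its function on the window. [cite: Balaban1989LargeFieldII, (1.98)-(1.101) p.390] -/
theorem largeFieldPolymerRepCan_of (hK : KPLogRep) (hG : LargeFieldGasRepCan) : LargeFieldPolymerRepCan := by
  intro L
  obtain ⟨pS, hLL⟩ := hG L
  refine ⟨pS, fun b₀ p₀ hb hpS hp => ?_⟩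
  obtain ⟨γ₁, hγ₁, κ, hκ, hL1⟩ := hLL b₀ p₀ hb hpS hp
  refine ⟨γ₁, hγ₁, κ, hκ, fun F γ hFL hγ hγ1 => ?_⟩
  obtain ⟨Ψ, hΨ0, hΨt, hL2⟩ := hL1 F γ hFL hγ hγ1
  refine ⟨Ψ, hΨ0, hΨt, ?_⟩
  intro ν hνK hνd J K hJK ρ hρpos hνρ hρcont hgpos
  obtain ⟨c, w, hgas, hid⟩ := hL2 ν hνK hνd J K hJK ρ hρpos hνρ hρcont hgpos
  have hrep := polymerRepOn_const_add (hK (F.P J) {U | PlaqSmall (θBal F.L γ b₀ p₀ J) U} κ (Ψ J) hκ.le w hgas) c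
  refine polymerRepOn_congr hrep fun U hU => ?_
  have hρ := hρpos U hU
  have hg := hgpos U hU
  have hUid := hid U hU
  have hec : 0 < Real.exp c := Real.exp_pos c
  have hZpos : 0 < gasZ w U := by
    have h1 : 0 < Real.exp c * heightDensityCan F γ hJK (histGood F ℰp (θBal F.L γ b₀ p₀) K J) U := mul_pos hec hg
    by_contra hle
    have : ρ U ≤ 0 := by rw [hUid]; exact mul_nonpos_of_nonneg_of_nonpos h1.le (not_lt.mp hle)
    exact absurd hρ (not_lt.mpr this)
  have hlog : Real.log (ρ U) = c + Real.log (heightDensityCan F γ hJK (histGood F ℰp (θBal F.L γ b₀ p₀) K J) U) + Real.log (gasZ w U) := by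
    rw [hUid, Real.log_mul (mul_pos hec hg).ne' hZpos.ne', Real.log_mul hec.ne' hg.ne', Real.log_exp]
  show Real.log (ρ U) - Real.log (heightDensityCan F γ hJK (histGood F ℰp (θBal F.L γ b₀ p₀) K J) U) = c + Real.log (gasZ w U)
  rw [hlog]; ring

/-! ## §4 Stubs and the LFRᶜ this file delivers -/

/-- **KPL — CLOSED BY NAME (v3)** on pen ym-ust-20520-w3 g15's Theorems-side `kpLogRep` (KPL-A/B/C/D: one-polymer deletion induction for `log Z`,
the Taylor–Möbius expansion of the truncated weights, the alternating-sign majorant [ScottSokal2005, Prop. 2.8], and the generic gauge-free packaging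
`polymerRep_of_kpGas` into `PolymerRepOn` with field-UNIFORM weights `‖Φ^T(−w̄;C)‖` and the pinned [KoteckyPreiss1986] (4) bound).  δ-unfolding only.
[cite: KoteckyPreiss1986, Theorem p.492 (2),(4); ScottSokal2005, Prop. 2.8] -/
theorem stub_kpLogRep : KPLogRep :=
  Summit.QuantumFields.YangMills.Theorems.FluctuationComparisonRegPrIntLS2BetaKPLogRep.kpLogRep

/-- **STUB LFG** (XL, the 𝐑-operation for the T³ tower in gas form). [cite: Balaban1989LargeFieldII, (1.90) p.388, (1.97) p.389, (1.100) p.390] -/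
theorem stub_largeFieldGasRepCan : LargeFieldGasRepCan := by
  sorry

/-- **LFRᶜ FROM THE TABLE** (by-text closure of LINE g18-1 v7's `stub`-free hypothesis `LargeFieldPolymerRepCan` / LINE g17-1 v5's `stub_largeFieldPolymerRep`).
[cite: Balaban1989LargeFieldII, (1.98)-(1.101) p.390] -/
theorem largeFieldPolymerRepCan_of_stubs : LargeFieldPolymerRepCan :=
  largeFieldPolymerRepCan_of stub_kpLogRep stub_largeFieldGasRepCan

end Summit.QuantumFields.YangMills.Cruxes.FluctuationComparisonRegPrIntL.RunPairOrgan.LargeFieldGas
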